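import Literature.MathematicalPhysics.QuantumFieldTheory.LatticeMaxwellFreeEnergyLimit
import HarnessLib

/-!
# A RATE for Theorem 15.2: `|log Z_M(B_n)/n^d − L_d| ≤ C_d (log n + 1)/n`

Helper for the crux `FreeEnergyRate` (stmt-QuantumFields-22402) of route `EntropyBudgetEquipartition` — the one
non-quantitative analytic input of the tree's proof of Chatterjee's free-energy asymptotics (arXiv:1602.01222,
Thm. 2.1 / Thm. 1.1, tree `chatterjee_freeEnergy_holds`) is Theorem 15.2, the EXISTENCE of the lattice-Maxwell free
energy per site `L_d = lim_n log Z_M(B_n)/n^d` (tree `LatticeMaxwell.tendsto_logZM_div`). Any POWER rate in `β` for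
the Yang–Mills free energy (both registered stubs `stub_lowerRate` / `stub_upperRate` of the crux, which compare the
pressure with Gaussian box partition functions at side `ℓ = β^c`) needs a RATE in `n` here. This file proves it from
the tree's own quantitative consistency estimates (`LatticeMaxwell.abs_fM_dyadic_le`,
`LatticeMaxwell.abs_fM_sub_dyadic_le`), by telescoping the dyadic increments against the exact potential
`Φ(j) = 2C((d+1)(j+3) + 2d + 4)/2^j` (`Φ(j) − Φ(j+1)` IS the dyadic increment bound; written out inline, no
definition is introduced) and passing to the limit:

* `abs_lim_sub_fM_dyadic_le`: `|L − f(2^k+1)| ≤ Φ(k)`;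
* `abs_fM_sub_lim_le`: `|f(n) − L| ≤ 4C(9d+13)·(log n + 1)/n` for every `n ≥ 2` (`C = LatticeMaxwell.Cke d`);
* `exists_maxwellFreeEnergy_rate`: packaged with the limit of `tendsto_logZM_div`.

Pure real analysis on top of proved tree lemmas; no gauge theory, no named fact. HONEST LABEL: a lemma about the free
lattice Maxwell (Gaussian) theory; it proves nothing about the Yang–Mills mass gap (the route it serves targets the
RECORD-label rung R2ξ-G `XiPow`, an UPPER bound on the lattice gap, not the Clay statement).

References: S. Chatterjee, *The leading term of the Yang–Mills free energy*, J. Funct. Anal. 271 (2016),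
arXiv:1602.01222, §15, Thm. 15.2 (existence only; the rate is not in print but is implicit in the proof).
-/

noncomputable section

namespace Summit.QuantumFields.YangMills.Theorems.FreeEnergyRate

open Filter Topology
open Literature.MathematicalPhysics.QuantumFieldTheory
open Literature.MathematicalPhysics.QuantumFieldTheory.LatticeMaxwell
open Literature.MathematicalPhysics.QuantumFieldTheory.ChatterjeeAssembly

variable {d : ℕ}

/-- `Φ(j) = 2C((d+1)(j+3) + (2d+4))/2^j ≥ 0` — the telescoping potential (`C = Cke d`) majorising the dyadic
tail `∑_{i ≥ j} δ_i` of the increments `δ_i` of `LatticeMaxwell.abs_fM_dyadic_le` (written out; no definition is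
introduced). -/
theorem dyadicTail_nonneg (d j : ℕ) :
    (0 : ℝ) ≤ 2 * Cke d * (((d : ℝ) + 1) * (j + 3) + (2 * d + 4)) / 2 ^ j := by
  have : 0 ≤ Cke d := by unfold Cke; positivity
  positivity

/-- The exact telescoping identity `Φ(j) − Φ(j+1) = δ_j = C((d+1)(j+2) + (2d+4))/2^j`. -/
theorem dyadicTail_sub_succ (d j : ℕ) :
    2 * Cke d * (((d : ℝ) + 1) * (j + 3) + (2 * d + 4)) / 2 ^ j -
        2 * Cke d * (((d : ℝ) + 1) * ((j + 1 : ℕ) + 3) + (2 * d + 4)) / 2 ^ (j + 1) =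
      Cke d * (((d : ℝ) + 1) * (j + 2) + (2 * d + 4)) / 2 ^ j := by
  rw [pow_succ]
  push_cast
  have h2 : (2 : ℝ) ^ j ≠ 0 := by positivity
  field_simp
  ring

/-- Finite telescoping along the dyadic subsequence: `|f(2^{k+m}+1) − f(2^k+1)| ≤ Φ(k) − Φ(k+m)`.
[cite: arXiv160201222, Thm. 15.2 (proof)] -/
theorem abs_fM_dyadic_sub_le_tail (hd : 1 ≤ d) (k m : ℕ) :
    |fM d (2 ^ (k + m) + 1) - fM d (2 ^ k + 1)| ≤
      2 * Cke d * (((d : ℝ) + 1) * (k + 3) + (2 * d + 4)) / 2 ^ k -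
        2 * Cke d * (((d : ℝ) + 1) * ((k + m : ℕ) + 3) + (2 * d + 4)) / 2 ^ (k + m) := by
  induction m with
  | zero => simp
  | succ m ih =>
    have hstep := abs_fM_dyadic_le (d := d) hd (k + m)
    have hδ := dyadicTail_sub_succ d (k + m)
    have hks : k + (m + 1) = k + m + 1 := by omega
    calc |fM d (2 ^ (k + (m + 1)) + 1) - fM d (2 ^ k + 1)|
        ≤ |fM d (2 ^ (k + m + 1) + 1) - fM d (2 ^ (k + m) + 1)| +
            |fM d (2 ^ (k + m) + 1) - fM d (2 ^ k + 1)| := by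
          rw [hks]; exact abs_sub_le _ _ _
      _ ≤ Cke d * (((d : ℝ) + 1) * ((k + m : ℕ) + 2) + (2 * d + 4)) / 2 ^ (k + m) +
            (2 * Cke d * (((d : ℝ) + 1) * (k + 3) + (2 * d + 4)) / 2 ^ k -
              2 * Cke d * (((d : ℝ) + 1) * ((k + m : ℕ) + 3) + (2 * d + 4)) / 2 ^ (k + m)) :=
          add_le_add hstep ih
      _ = 2 * Cke d * (((d : ℝ) + 1) * (k + 3) + (2 * d + 4)) / 2 ^ k -
            2 * Cke d * (((d : ℝ) + 1) * ((k + (m + 1) : ℕ) + 3) + (2 * d + 4)) / 2 ^ (k + (m + 1)) := by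
          rw [hks, ← hδ]; ring

/-- **The dyadic tail bound**: if `log Z_M(B_n)/n^d → L` then `|L − f(2^k+1)| ≤ Φ(k)` for every `k`.
[cite: arXiv160201222, Thm. 15.2 (proof)] -/
theorem abs_lim_sub_fM_dyadic_le (hd : 1 ≤ d) {L : ℝ}
    (hL : Tendsto (fun n : ℕ => logZM d n / (n : ℝ) ^ d) atTop (𝓝 L)) (k : ℕ) :
    |L - fM d (2 ^ k + 1)| ≤ 2 * Cke d * (((d : ℝ) + 1) * (k + 3) + (2 * d + 4)) / 2 ^ k := by
  have h1 : Tendsto (fun m : ℕ => 2 ^ (k + m) + 1) atTop atTop := by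
    refine tendsto_atTop_mono (fun m => ?_) tendsto_id
    have : m < 2 ^ (k + m) :=
      (Nat.lt_two_pow_self).trans_le (Nat.pow_le_pow_right two_pos (Nat.le_add_left m k))
    show m ≤ 2 ^ (k + m) + 1
    omega
  have hsub : Tendsto (fun m : ℕ => fM d (2 ^ (k + m) + 1)) atTop (𝓝 L) := hL.comp h1
  have hg : Tendsto (fun m : ℕ => |fM d (2 ^ (k + m) + 1) - fM d (2 ^ k + 1)|) atTop
      (𝓝 (|L - fM d (2 ^ k + 1)|)) := (hsub.sub_const _).abs
  refine le_of_tendsto' hg fun m => ?_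
  exact (abs_fM_dyadic_sub_le_tail hd k m).trans (sub_le_self _ (dyadicTail_nonneg d (k + m)))

/-- The rate constant `C_d = 4·Cke(d)·(9d+13)` is non-negative. -/
theorem maxwellRateConst_nonneg (d : ℕ) : (0 : ℝ) ≤ 4 * Cke d * (9 * d + 13) := by
  have : 0 ≤ Cke d := by unfold Cke; positivity
  positivity

/-- **Theorem 15.2 with a rate.** If `log Z_M(B_n)/n^d → L` (`d ≥ 1`), then for every `n ≥ 2`
`|log Z_M(B_n)/n^d − L| ≤ C_d (log n + 1)/n`, `C_d = 4·Cke(d)·(9d+13)`. Proof: common refinement with the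
dyadic scale `2^k+1`, `k = ⌊log₂(n−1)⌋` (`abs_fM_sub_dyadic_le`), plus the dyadic tail (`abs_lim_sub_fM_dyadic_le`),
and `2^k ≥ n/2`, `k ≤ 2 log n`. [cite: arXiv160201222, Thm. 15.2 (rate implicit in the proof, not stated in print)] -/
theorem abs_fM_sub_lim_le (hd : 1 ≤ d) {L : ℝ}
    (hL : Tendsto (fun n : ℕ => logZM d n / (n : ℝ) ^ d) atTop (𝓝 L)) {l : ℕ} (hl : 2 ≤ l) :
    |fM d l - L| ≤ 4 * Cke d * (9 * d + 13) * (Real.log l + 1) / l := by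
  have hC : 0 ≤ Cke d := by unfold Cke; positivity
  have hl0 : (0 : ℝ) < l := by exact_mod_cast (show 0 < l by omega)
  have hlog0 : 0 ≤ Real.log l := Real.log_nonneg (by exact_mod_cast (show 1 ≤ l by omega))
  have hd0 : (0 : ℝ) ≤ d := Nat.cast_nonneg d
  rcases Nat.lt_or_ge l 3 with hl3 | hl3
  · -- `l = 2 = 2^0 + 1` is itself dyadic
    have hl2 : l = 2 := by omega
    subst hl2
    have h := abs_lim_sub_fM_dyadic_le (d := d) hd hL 0
    rw [pow_zero, show (1 : ℕ) + 1 = 2 from rfl, abs_sub_comm] at h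
    refine h.trans ?_
    push_cast
    rw [le_div_iff₀ (by norm_num : (0 : ℝ) < 2)]
    have hlog2 : 0 ≤ Real.log (2 : ℝ) := Real.log_nonneg one_le_two
    nlinarith [mul_nonneg hC hlog2, mul_nonneg (mul_nonneg hC hlog2) hd0, mul_nonneg hC hd0]
  -- `l ≥ 3`: refine to the dyadic scale `2^k + 1`, `k = ⌊log₂ (l-1)⌋`
  set k := Nat.log 2 (l - 1) with hk
  have hk1 : 2 ^ k ≤ l - 1 := Nat.pow_log_le_self 2 (by omega)
  have hk2 : l - 1 < 2 ^ (k + 1) := Nat.lt_pow_succ_log_self (by norm_num) _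
  have h2k0 : (0 : ℝ) < 2 ^ k := by positivity
  have hl2k : (l : ℝ) ≤ 2 * 2 ^ k := by
    have : l ≤ 2 ^ (k + 1) := by omega
    have : (l : ℝ) ≤ (2 : ℝ) ^ (k + 1) := by exact_mod_cast this
    rw [pow_succ] at this
    linarith
  have hklog : (k : ℝ) ≤ 2 * Real.log l := by
    have h2kl : (2 : ℝ) ^ k ≤ l := by
      have : ((2 ^ k : ℕ) : ℝ) ≤ ((l - 1 : ℕ) : ℝ) := by exact_mod_cast hk1
      push_cast at this
      have h' : ((l - 1 : ℕ) : ℝ) ≤ l := by exact_mod_cast Nat.sub_le l 1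
      linarith
    have hlog := Real.log_le_log h2k0 h2kl
    rw [Real.log_pow] at hlog
    have h2 := Real.log_two_gt_d9
    nlinarith
  have e1 := abs_fM_sub_dyadic_le (d := d) hd hl3
  have e2 := abs_lim_sub_fM_dyadic_le (d := d) hd hL k
  rw [abs_sub_comm] at e2
  -- sum of the two numerators
  set A₁ : ℝ := 2 * Cke d * (((d : ℝ) + 1) * (2 * k + 2) + (2 * d + 4)) with hA₁
  set A₂ : ℝ := 2 * Cke d * (((d : ℝ) + 1) * (k + 3) + (2 * d + 4)) with hA₂
  have hA : 0 ≤ A₁ + A₂ := by positivity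
  have hE : |fM d l - L| ≤ (A₁ + A₂) / 2 ^ k := by
    calc |fM d l - L| ≤ |fM d l - fM d (2 ^ k + 1)| + |fM d (2 ^ k + 1) - L| := abs_sub_le _ _ _
      _ ≤ A₁ / 2 ^ k + A₂ / 2 ^ k := add_le_add e1 (by simpa [hA₂] using e2)
      _ = (A₁ + A₂) / 2 ^ k := by ring
  have hnum : A₁ + A₂ ≤ 2 * Cke d * (9 * d + 13) * (Real.log l + 1) := by
    have hsum : A₁ + A₂ = 2 * Cke d * (((d : ℝ) + 1) * (3 * k + 5) + (4 * d + 8)) := by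
      rw [hA₁, hA₂]; ring
    rw [hsum]
    have hd1 : (0 : ℝ) ≤ (d : ℝ) + 1 := by positivity
    have i1 : ((d : ℝ) + 1) * (3 * k + 5) ≤ ((d : ℝ) + 1) * (6 * Real.log l + 5) :=
      mul_le_mul_of_nonneg_left (by linarith) hd1
    have i2 : ((d : ℝ) + 1) * (6 * Real.log l + 5) + (4 * d + 8) ≤ (9 * d + 13) * (Real.log l + 1) := by
      nlinarith
    have i3 : ((d : ℝ) + 1) * (3 * k + 5) + (4 * d + 8) ≤ (9 * d + 13) * (Real.log l + 1) := by
      linarith [i1, i2]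
    have := mul_le_mul_of_nonneg_left i3 (by positivity : (0 : ℝ) ≤ 2 * Cke d)
    linarith
  have hden : (A₁ + A₂) / 2 ^ k ≤ 2 * (A₁ + A₂) / l := by
    have h' : (A₁ + A₂) / 2 ^ k ≤ (A₁ + A₂) / (l / 2) :=
      div_le_div_of_nonneg_left hA (by positivity) (by linarith)
    calc (A₁ + A₂) / 2 ^ k ≤ (A₁ + A₂) / (l / 2) := h'
      _ = 2 * (A₁ + A₂) / l := by field_simp
  calc |fM d l - L| ≤ 2 * (A₁ + A₂) / l := hE.trans hden
    _ ≤ 2 * (2 * Cke d * (9 * d + 13) * (Real.log l + 1)) / l := by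
        gcongr
    _ = 4 * Cke d * (9 * d + 13) * (Real.log l + 1) / l := by ring

/-- **The lattice-Maxwell free energy per site converges at rate `(log n)/n`** (`d ≥ 1`): there are `L` (the limit of
Theorem 15.2, tree `LatticeMaxwell.tendsto_logZM_div`) and an explicit `C = C_d` with
`|log Z_M(B_n)/n^d − L| ≤ C (log n + 1)/n` for all `n ≥ 2`. [cite: arXiv160201222, Thm. 15.2 (rate implicit in the proof)] -/
theorem exists_maxwellFreeEnergy_rate (hd : 1 ≤ d) :
    ∃ L : ℝ, Tendsto (fun n : ℕ => logZM d n / (n : ℝ) ^ d) atTop (𝓝 L) ∧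
      ∀ n : ℕ, 2 ≤ n → |logZM d n / (n : ℝ) ^ d - L| ≤ 4 * Cke d * (9 * d + 13) * (Real.log n + 1) / n := by
  obtain ⟨L, hL⟩ := tendsto_logZM_div (d := d) hd
  exact ⟨L, hL, fun n hn => abs_fM_sub_lim_le hd hL hn⟩

end Summit.QuantumFields.YangMills.Theorems.FreeEnergyRate

end
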